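import Literature.Algebra.Homology.OrderedCechPairSystem
import HarnessLib

/-!
# Functoriality of the ordered Čech bicomplex of a pair-system on NON-EMPTY pairs (Stacks 0BEC, 012K)

Layer `Literature/Algebra/Homology` (constructions + proved lemmas; 0 named facts, no instance, no notation; pure
homological algebra over a commutative ring `A`). The ordered Čech bicomplex `Č•,•(P) = sysBicomplex P` of a pair-system
`P : Finset ι ⥤ Finset κ ⥤ ModuleCat A` (`Algebra/Homology/OrderedCechPairSystem`) only sees the values `P s t` at NON-EMPTY
`s`, `t` (simplices are non-empty finite sets; Görtz–Wedhorn II Def. 21.68). Hence linear isomorphisms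
`e s t : P s t ≃ P' s t` given for non-empty `s`, `t` and natural with respect to inclusions of non-empty members in
EACH variable induce an isomorphism of bicomplexes `Č•,•(P) ≅ Č•,•(P')` — the two-variable analogue of the tree's
`OrderedCechSystemMap.sysCochainMapNE` / `sysComplexIsoNE` (one variable), built from them column by column. This is the
form in which the sections `(s, t) ↦ Γ(U_s ×_S V_t, E ⊠ F)` of an external tensor product (affine for non-empty `s`, `t`
only) are compared with `(s, t) ↦ Γ(U_s, E) ⊗ Γ(V_t, F)`.

* `cochainEquivNE e t ht a : Čᵃ(P(·, t)) ≃ₗ[A] Čᵃ(P'(·, t))` — componentwise `e σ t` (`LinearEquiv.piCongrRight`);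
* `columnIsoNE e he₂ a : Č•(cochainSystem P a) ≅ Č•(cochainSystem P' a)` — `sysComplexIsoNE` in the `τ`-direction;
* **`sysBicomplexIsoNE e he₁ he₂ : sysBicomplex P ≅ sysBicomplex P'`** — `HomologicalComplex.Hom.isoOfComponents` of the
  columns; the outer (`σ`-) differentials match by `sysD_sysCochainMapNE`; `sysBicomplexIsoNE_hom_f_f_apply` (components).

Library only (cell `pub-hodge-ring2`, count-neutral); proves nothing about any crux, route or conjecture.

## References

* The Stacks Project, Tag 0BEC (Künneth formula: the double Čech complex), Tag 012K (double complexes). [StacksProject]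
* U. Görtz, T. Wedhorn, *Algebraic Geometry II* (2023), Def. 21.68 (p. 180). [GortzWedhorn2023]
-/

universe u

open CategoryTheory

set_option backward.isDefEq.respectTransparency false

noncomputable section

namespace Literature.Algebra.Homology

namespace OrderedCech

variable {A : Type u} [CommRing A] {ι κ : Type} [LinearOrder ι] [LinearOrder κ]
  {P P' : Finset ι ⥤ Finset κ ⥤ ModuleCat.{u} A}
  (e : ∀ (s : Finset ι) (t : Finset κ), s.Nonempty → t.Nonempty → ((P.obj s).obj t ≃ₗ[A] (P'.obj s).obj t))
  (he₁ : ∀ (s s' : Finset ι) (t : Finset κ) (hs : s.Nonempty) (hs' : s'.Nonempty) (ht : t.Nonempty) (h : s ⊆ s')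
    (x : (P.obj s).obj t),
    e s' t hs' ht (((P.map (homOfLE h)).app t).hom x) = ((P'.map (homOfLE h)).app t).hom (e s t hs ht x))
  (he₂ : ∀ (s : Finset ι) (t t' : Finset κ) (hs : s.Nonempty) (ht : t.Nonempty) (ht' : t'.Nonempty) (h : t ⊆ t')
    (x : (P.obj s).obj t),
    e s t' hs ht' (((P.obj s).map (homOfLE h)).hom x) = ((P'.obj s).map (homOfLE h)).hom (e s t hs ht x))

/-- **`Čᵃ(P(·, t)) ≃ₗ[A] Čᵃ(P'(·, t))`** for non-empty `t`: componentwise `e σ t` on `Π_{σ ∈ Simplex ι a} P σ t`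
(Mathlib `LinearEquiv.piCongrRight`; the two-variable analogue of `sysCochainMapNE`). [cite: GortzWedhorn2023, Def. 21.68 (p. 180)] -/
def cochainEquivNE (t : Finset κ) (ht : t.Nonempty) (a : ℤ) :
    SysCochain (P.flip.obj t) a ≃ₗ[A] SysCochain (P'.flip.obj t) a :=
  (LinearEquiv.piCongrRight fun σ : Simplex ι a => e σ.1 t σ.2.1 ht :
    (∀ σ : Simplex ι a, (P.obj σ.1).obj t) ≃ₗ[A] ∀ σ : Simplex ι a, (P'.obj σ.1).obj t)

omit [LinearOrder κ] in
/-- Components of `cochainEquivNE` (`rfl`). [cite: GortzWedhorn2023, Def. 21.68 (p. 180)] -/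
@[simp] theorem cochainEquivNE_apply (t : Finset κ) (ht : t.Nonempty) (a : ℤ) (g : SysCochain (P.flip.obj t) a)
    (σ : Simplex ι a) : cochainEquivNE e t ht a g σ = e σ.1 t σ.2.1 ht (g σ) := rfl

omit [LinearOrder κ] in
/-- `cochainEquivNE` is `sysCochainMapNE` of the maps `s ↦ e s t` on the `ι`-system `P(·, t)` (`rfl` on components).
[cite: GortzWedhorn2023, Def. 21.68 (p. 180)] -/
theorem cochainEquivNE_eq_sysCochainMapNE (t : Finset κ) (ht : t.Nonempty) (a : ℤ) (g : SysCochain (P.flip.obj t) a) :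
    cochainEquivNE e t ht a g =
      sysCochainMapNE (M := P.flip.obj t) (M' := P'.flip.obj t) (fun s hs => (e s t hs ht).toLinearMap) a g := by
  funext σ
  rfl

include he₁ in
omit [LinearOrder κ] in
/-- The `σ`-Čech differential commutes with `cochainEquivNE` (naturality of `e` in the first variable,
`sysD_sysCochainMapNE`). [cite: GortzWedhorn2023, Def. 21.68 (p. 180)] -/
theorem sysD_cochainEquivNE (t : Finset κ) (ht : t.Nonempty) (a : ℤ) (g : SysCochain (P.flip.obj t) a) :
    sysD (P'.flip.obj t) a (cochainEquivNE e t ht a g) = cochainEquivNE e t ht (a + 1) (sysD (P.flip.obj t) a g) := by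
  rw [cochainEquivNE_eq_sysCochainMapNE, cochainEquivNE_eq_sysCochainMapNE]
  exact sysD_sysCochainMapNE (M := P.flip.obj t) (M' := P'.flip.obj t) (fun s hs => (e s t hs ht).toLinearMap)
    (fun s s' hs hs' h x => he₁ s s' t hs hs' ht h x) g

include he₂ in
/-- **The columns `Č•(cochainSystem P a) ≅ Č•(cochainSystem P' a)`**: `sysComplexIsoNE` (in the `τ`-direction) of the
isomorphisms `cochainEquivNE e t ht a`, natural in non-empty `t` by the naturality of `e` in the second variable.
[cite: GortzWedhorn2023, Def. 21.68 (p. 180)] [cite: StacksProject, Tag 012K] -/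
def columnIsoNE (a : ℤ) : sysComplex (cochainSystem P a) ≅ sysComplex (cochainSystem P' a) :=
  sysComplexIsoNE (M := cochainSystem P a) (M' := cochainSystem P' a) (fun t ht => cochainEquivNE e t ht a)
    fun t t' ht ht' h g => by
      funext σ
      change e σ.1 t' σ.2.1 ht' (sysCochainMap (P.flip.map (homOfLE h)) a g σ) =
        sysCochainMap (P'.flip.map (homOfLE h)) a (cochainEquivNE e t ht a g) σ
      rw [sysCochainMap_apply, sysCochainMap_apply, Functor.flip_map_app, Functor.flip_map_app,
        cochainEquivNE_apply]
      exact he₂ σ.1 t t' σ.2.1 ht ht' h (g σ)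

/-- Components of `columnIsoNE` (`rfl`). [cite: GortzWedhorn2023, Def. 21.68 (p. 180)] -/
theorem columnIsoNE_hom_f_apply (a b : ℤ) (g : SysCochain (cochainSystem P a) b) (τ : Simplex κ b) :
    ((columnIsoNE e he₂ a).hom.f b).hom g τ = cochainEquivNE e τ.1 τ.2.1 a (g τ) :=
  sysComplexIsoNE_hom_f_apply _ _ b g τ

include he₁ he₂ in
/-- **`Č•,•(P) ≅ Č•,•(P')` from isomorphisms `P s t ≅ P' s t` on NON-EMPTY `s`, `t`, natural in each variable with respect
to inclusions of non-empty members** (the bicomplex never sees `s = ∅` or `t = ∅`): the columns are `columnIsoNE`, and they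
commute with the outer (`σ`-Čech) differentials by `sysD_cochainEquivNE`. [cite: StacksProject, Tag 0BEC] [cite: StacksProject, Tag 012K] -/
def sysBicomplexIsoNE : sysBicomplex P ≅ sysBicomplex P' :=
  HomologicalComplex.Hom.isoOfComponents (fun a => columnIsoNE e he₂ a) fun a a' haa' => by
    subst haa'
    refine HomologicalComplex.hom_ext _ _ fun b => ?_
    ext g
    rw [HomologicalComplex.comp_f, HomologicalComplex.comp_f, ModuleCat.hom_comp, ModuleCat.hom_comp,
      LinearMap.comp_apply, LinearMap.comp_apply]
    erw [sysBicomplex_d_f_apply, sysBicomplex_d_f_apply]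
    funext τ σ
    change (sysCochainMap (cochainSystemD P' a) b (((columnIsoNE e he₂ a).hom.f b).hom g)) τ σ =
      ((columnIsoNE e he₂ (a + 1)).hom.f b).hom (sysCochainMap (cochainSystemD P a) b g) τ σ
    rw [sysCochainMap_apply, cochainSystemD_app_apply, columnIsoNE_hom_f_apply, columnIsoNE_hom_f_apply,
      sysCochainMap_apply, cochainSystemD_app_apply, sysD_cochainEquivNE e he₁]

/-- Components of `sysBicomplexIsoNE`: on `g ∈ Čᵃ,ᵇ(P) = Π_τ Π_σ P σ τ` it is `e σ τ` componentwise (`rfl`).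
[cite: StacksProject, Tag 0BEC] -/
theorem sysBicomplexIsoNE_hom_f_f_apply (a b : ℤ) (g : SysCochain (cochainSystem P a) b) (τ : Simplex κ b)
    (σ : Simplex ι a) :
    (((sysBicomplexIsoNE e he₁ he₂).hom.f a).f b).hom g τ σ = e σ.1 τ.1 σ.2.1 τ.2.1 (g τ σ) := rfl

end OrderedCech

end Literature.Algebra.Homology

end
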